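import Literature.Analysis.FluidPDE.ClassicalBoundedWeak
import HarnessLib

/-!
# Classical solutions of the STOKES system are weak Stokes solutions on open slabs
# (route `AngularGalerkinLadder`, crux K1 `RungBlowupCofinal`; analytic helper, theorems only)

Cell `ns-blowup`, seat `ns-blowup-circuit` (g12, AGL Lean seat). Helper file for
`stmt-NavierStokesRegularity-19959` (K1 of route №8) serving the line
`Cruxes/RungBlowupCofinal/Lines/qlwave.lean` (mean–wave rung profiles), support target (S4) of its
card «PURE-WAVE EXCLUSION» — part 2a of the chain: the weak identity that feeds the tree's KNSS
Lemma 3.1 (by duality) in `AncientStokesLiouville.lean` (part 2b).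

A classical solution of the STOKES system `∂ₜu = νΔu − ∇p`, `div u = 0` is rendered WITHOUT a new
predicate as a classical forced Navier–Stokes solution `IsClassicalNSSolutionOn S ν d u p` whose
force IS its own nonlinearity, `d(t) = (u(t)·∇)u(t)` (so the momentum equation reads
`∂ₜu = νΔu − ∇p` verbatim, and the tree's time-translation / restriction lemmas apply).

* `integral_inner_timeDerivWithin_test_stokes` — the Stokes slice identity
  `∫ ⟪∂ₜu(t), ψt⟫ = ν ∫ ⟪u(t), Δψt⟫` for `C²` compactly supported divergence-free `ψt` (the
  tree's `integral_inner_timeDerivWithin_test`; the force cancels the trilinear term).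
* `weakStokes_of_classical` — on an open slab `(a, b)`, `∫ₐᵇ ∫ (⟪u, ∂ₜψ⟫ + ν⟪u, Δψ⟫) = 0` for
  smooth compactly supported divergence-free space–time tests (fundamental theorem of calculus on
  time lines; proof adapted from the tree's `IsClassicalNSSolutionOn.isBoundedWeakNSSolutionOn`,
  `Literature/Analysis/FluidPDE/ClassicalBoundedWeak.lean`); `weakStokes_of_classical_one` — the
  `ν = 1` form `∫∫⟪u, ∂ₜψ + Δψ⟫ = 0` consumed by `exists_ae_eq_heatExtension_add_const_of_weakStokes`.

No bound on `u` or `p` is needed. LABEL: KERNEL (calculus). Nothing here asserts a Theses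
declaration; no definition, no named fact, no sorry. WHAT THIS IS NOT: not Navier–Stokes
evidence — a statement about the LINEAR Stokes system. References: [cite: Leray1934, §III (17)
p. 206]; [cite: KochNadirashviliSereginSverak2009, §4 (ii) (arXiv:0709.3599 p. 8)].
-/

noncomputable section

namespace Summit.NavierStokesRegularity.AngularGalerkinLadderClassicalWeakStokes

open Set Function MeasureTheory Filter Topology TopologicalSpace InnerProductSpace
open scoped RealInnerProductSpace Laplacian ContDiff
open Literature.Analysis.FluidPDE Literature.Analysis

variable {E : Type*} [NormedAddCommGroup E] [InnerProductSpace ℝ E] [FiniteDimensional ℝ E]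
  [MeasurableSpace E] [BorelSpace E]

/-! ## §1 Classical Stokes solutions are weak Stokes solutions on open slabs -/

/-- **The Stokes slice identity.** For a classical solution of the forced Navier–Stokes system
on a time set `S` of unique differentiability whose force is its own nonlinearity
(`d(t) = (u(t)·∇)u(t)`, i.e. `(u, p)` solves the STOKES system `∂ₜu = νΔu − ∇p`, `div u = 0`),
`t ∈ S`, and a `C²` compactly supported divergence-free field `ψt`:
`∫ ⟪∂ₜu(t), ψt⟫ = ν ∫ ⟪u(t), Δψt⟫` — the tree's slice identity
`integral_inner_timeDerivWithin_test`, in which the force term `∫⟪(u·∇)u, ψt⟫` cancels the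
trilinear term `∫⟪u, (u·∇)ψt⟫` (`integral_inner_convect_add_eq_zero`, `div u = 0`).
[cite: Leray1934, (17) p. 206] -/
theorem integral_inner_timeDerivWithin_test_stokes {S : Set ℝ} {ν : ℝ} {u d : ℝ → E → E}
    {p : ℝ → E → ℝ} (h : IsClassicalNSSolutionOn S ν d u p) (hS : UniqueDiffOn ℝ S)
    (hd : ∀ t ∈ S, ∀ x, d t x = convect (u t) (u t) x) {t : ℝ} (ht : t ∈ S) {ψt : E → E}
    (hψ : ContDiff ℝ 2 ψt) (hc : HasCompactSupport ψt) (hdiv : VectorCalculus.IsDivFree ψt) :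
    ∫ x, ⟪timeDerivWithin S u t x, ψt x⟫ = ν * ∫ x, ⟪u t x, (Δ ψt) x⟫ := by
  have key := h.integral_inner_timeDerivWithin_test hS ht hψ hc hdiv
  have hu2 : ContDiff ℝ 2 (u t) := contDiff_infty.1 (h.contDiff_velocity ht) 2
  have hu1 : ContDiff ℝ 1 (u t) := hu2.of_le one_le_two
  have hψ1 : ContDiff ℝ 1 ψt := hψ.of_le one_le_two
  have huc : Continuous (u t) := hu1.continuous
  have hψc : Continuous ψt := hψ1.continuous
  -- the force term is `−∫⟪u, (u·∇)ψt⟫`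
  have eC : ∫ x, ⟪convect (u t) (u t) x, ψt x⟫ = -∫ x, ⟪u t x, convect (u t) ψt x⟫ := by
    have h0 := integral_inner_convect_add_eq_zero hu1 hu1 hψ1 hc
    have hz : ∫ x, VectorCalculus.divergence (u t) x * ⟪u t x, ψt x⟫ = 0 := by
      simp [h.divFree t ht _]
    linarith
  have hF : ∀ x, ⟪d t x, ψt x⟫ = ⟪convect (u t) (u t) x, ψt x⟫ := fun x => by rw [hd t ht x]
  have iC' : Integrable (fun x => ⟪u t x, convect (u t) ψt x⟫) (volume : Measure E) :=
    integrable_inner_of_hasCompactSupport_right huc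
      ((hψ1.continuous_fderiv one_ne_zero).clm_apply huc)
      ((hc.fderiv (𝕜 := ℝ)).mono fun x hx => by
        contrapose! hx; simp only [mem_support, not_not] at hx; simp [convect, hx])
  have iL' : Integrable (fun x => ν * ⟪u t x, (Δ ψt) x⟫) (volume : Measure E) :=
    (integrable_inner_of_hasCompactSupport_right huc (continuous_laplacian hψ)
      (hc.mono' fun x hx => by
        contrapose! hx; simp [laplacian_eq_zero_of_notMem_tsupport hx])).const_mul ν
  have iF : Integrable (fun x => ⟪d t x, ψt x⟫) (volume : Measure E) := by
    have iC : Integrable (fun x => ⟪convect (u t) (u t) x, ψt x⟫) (volume : Measure E) :=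
      integrable_inner_of_hasCompactSupport_right
        ((hu1.continuous_fderiv one_ne_zero).clm_apply huc) hψc hc
    exact iC.congr (Eventually.of_forall fun x => (hF x).symm)
  have i3 : Integrable (fun x => ⟪u t x, convect (u t) ψt x⟫ + ν * ⟪u t x, (Δ ψt) x⟫)
      (volume : Measure E) := iC'.add iL'
  rw [key, integral_add i3 iF, integral_add iC' iL', integral_const_mul,
    integral_congr_ae (Eventually.of_forall hF), eC]
  ring

/-- **Classical Stokes solutions are weak Stokes solutions on open slabs.** Let `(u, p)` solve
the Stokes system classically on the time set `(a, b)` (rendered as a classical forced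
Navier–Stokes solution whose force is its own nonlinearity). Then for every smooth compactly
supported divergence-free space–time test field `ψ` on the slab `(a, b) × E`,
`∫ₐᵇ ∫ (⟪u, ∂ₜψ⟫ + ν⟪u, Δψ⟫) = 0`: the Stokes slice identity turns the integrand into
`d/dt ∫⟪u, ψ⟫` on a compact time interval containing the time support of `ψ`, and both boundary
terms vanish (proof adapted from the tree's `IsClassicalNSSolutionOn.isBoundedWeakNSSolutionOn`,
`Literature/Analysis/FluidPDE/ClassicalBoundedWeak.lean`). No bound on `u` or `p` is needed.
[cite: Leray1934, (17) p. 206] -/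
theorem weakStokes_of_classical {a b ν : ℝ} {u d : ℝ → E → E} {p : ℝ → E → ℝ}
    (h : IsClassicalNSSolutionOn (Ioo a b) ν d u p)
    (hd : ∀ t ∈ Ioo a b, ∀ x, d t x = convect (u t) (u t) x)
    (ψ : ℝ → E → E) (hψ : IsSpaceTimeTestOn (slab E (Ioo a b) isOpen_Ioo) ψ)
    (hdiv : ∀ t, VectorCalculus.IsDivFree (ψ t)) :
    ∫ t in Ioo a b, ∫ x, (⟪u t x, timeDeriv ψ t x⟫ + ν * ⟪u t x, (Δ (ψ t)) x⟫) = 0 := by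
  -- adapted from `IsClassicalNSSolutionOn.isBoundedWeakNSSolutionOn` (ClassicalBoundedWeak)
  rcases le_or_gt b a with hab | hab
  · simp [Ioo_eq_empty_of_le hab]
  -- time support `[a', b'] ⊂ (a, b)` and a compact interval `[a₁, b₁]` around it
  obtain ⟨a', b', haa', ha'b', hb'b, hsupp⟩ := hψ.exists_time_support_Ioo hab
  set a₁ : ℝ := (a + a') / 2 with ha₁
  set b₁ : ℝ := (b' + b) / 2 with hb₁
  have haa₁ : a < a₁ := by rw [ha₁]; linarith
  have ha₁a' : a₁ < a' := by rw [ha₁]; linarith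
  have hb'b₁ : b' < b₁ := by rw [hb₁]; linarith
  have hb₁b : b₁ < b := by rw [hb₁]; linarith
  have ha₁b₁ : a₁ < b₁ := by linarith
  have hsub : Icc a₁ b₁ ⊆ Ioo a b := fun t ht => ⟨haa₁.trans_le ht.1, ht.2.trans_lt hb₁b⟩
  set S₀ : Set ℝ := Icc a₁ b₁ with hS₀
  have hU : UniqueDiffOn ℝ S₀ := uniqueDiffOn_Icc ha₁b₁
  have h₀ : IsClassicalNSSolutionOn S₀ ν d u p := h.mono hsub hU
  have hd₀ : ∀ t ∈ S₀, ∀ x, d t x = convect (u t) (u t) x := fun t ht => hd t (hsub ht)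
  have hu₀ : ContinuousOn (uncurry u) (S₀ ×ˢ univ) := h₀.smooth_velocity.continuousOn
  have hdt_cont : ContinuousOn (uncurry (timeDerivWithin S₀ u)) (S₀ ×ˢ univ) :=
    (h₀.smooth_velocity.timeDerivWithin hU).continuousOn
  -- values of `ψ` and its derived fields off the time support
  have hψ0 : ∀ t, t ∉ Icc a' b' → ∀ x, ψ t x = 0 := fun t ht x => by rw [hsupp t ht]; rfl
  have hψa₁ : ∀ x, ψ a₁ x = 0 := hψ0 a₁ fun ht => (not_le.2 ha₁a') ht.1
  have hψb₁ : ∀ x, ψ b₁ x = 0 := hψ0 b₁ fun ht => (not_le.2 hb'b₁) ht.2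
  have hzero : ∀ t, t ∉ Icc a' b' → ∀ x,
      ⟪u t x, timeDeriv ψ t x⟫ + ν * ⟪u t x, Δ (ψ t) x⟫ = 0 := by
    intro t ht x
    have hopen : IsOpen (Icc a' b')ᶜ := isClosed_Icc.isOpen_compl
    have hnear : (fun s => ψ s x) =ᶠ[𝓝 t] fun _ => (0 : E) :=
      Filter.eventually_of_mem (hopen.mem_nhds ht) fun s hs => hψ0 s hs x
    have h1 : timeDeriv ψ t x = 0 := by
      rw [timeDeriv_apply, hnear.deriv_eq, deriv_const]
    have h3 : Δ (ψ t) x = 0 :=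
      laplacian_eq_zero_of_notMem_tsupport (by
        rw [hsupp t ht, tsupport_eq_empty_iff.2 rfl]; exact notMem_empty x)
    rw [h1, h3]
    simp
  -- reduce the time integral to `(a₁, b₁)`
  rw [setIntegral_eq_of_subset_of_forall_sdiff_eq_zero (measurableSet_Ioo (a := a) (b := b))
    (Ioo_subset_Ioo haa₁.le hb₁b.le : Ioo a₁ b₁ ⊆ Ioo a b)]
  swap
  · intro t ht
    have ht' : t ∉ Icc a' b' := fun h' => ht.2 ⟨ha₁a'.trans_le h'.1, h'.2.trans_lt hb'b₁⟩
    simp only [hzero t ht', integral_zero]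
  -- the compact `x`-shadow of the test field
  obtain ⟨K, hK, hKt⟩ := hψ.exists_compact_slice_subset
  have hψK : ∀ t, ∀ x ∉ K, ψ t x = 0 := fun t x hx =>
    image_eq_zero_of_notMem_tsupport fun h' => hx (hKt t h')
  -- the space–time integrand `∂ₜ ⟪u, ψ⟫`
  set D : ℝ × E → ℝ := fun z => ⟪u z.1 z.2, timeDeriv ψ z.1 z.2⟫ +
    ⟪timeDerivWithin S₀ u z.1 z.2, ψ z.1 z.2⟫ with hD
  have hDcont : ContinuousOn D (Icc a₁ b₁ ×ˢ univ) := by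
    refine ContinuousOn.add (ContinuousOn.inner hu₀ hψ.continuous_timeDeriv.continuousOn)
      (ContinuousOn.inner hdt_cont ?_)
    exact hψ.contDiff.continuous.continuousOn
  have hDK : ∀ t ∈ Icc a₁ b₁, ∀ x ∉ K, D (t, x) = 0 := fun t _ x hx => by
    simp only [hD]
    rw [hψK t x hx, timeDeriv_eq_zero_of_forall (fun s => hψK s x hx)]
    simp
  have hDint := integrable_prod_of_continuousOn hK hDcont hDK
  -- slice identity for every `t ∈ (a₁, b₁)`
  have hslice : ∀ t ∈ Ioo a₁ b₁, ∫ x, (⟪u t x, timeDeriv ψ t x⟫ + ν * ⟪u t x, (Δ (ψ t)) x⟫) =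
      ∫ x, D (t, x) := by
    intro t ht
    have ht' : t ∈ S₀ := Ioo_subset_Icc_self ht
    have hψ2 : ContDiff ℝ 2 (ψ t) := contDiff_infty.1 (hψ.contDiff_slice t) 2
    have key := integral_inner_timeDerivWithin_test_stokes h₀ hU hd₀ ht' hψ2
      (hψ.hasCompactSupport_slice t) (hdiv t)
    have huc : Continuous (u t) := (h₀.contDiff_velocity ht').continuous
    have i1 : Integrable (fun x => ⟪u t x, timeDeriv ψ t x⟫) (volume : Measure E) :=
      integrable_inner_of_hasCompactSupport_right huc
        (hψ.continuous_timeDeriv.comp (Continuous.prodMk_right t))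
        (HasCompactSupport.intro hK fun x hx => timeDeriv_eq_zero_of_forall
          (fun s => hψK s x hx) t)
    have i2 : Integrable (fun x => ⟪timeDerivWithin S₀ u t x, ψ t x⟫) (volume : Measure E) :=
      integrable_inner_of_hasCompactSupport_right
        (((h₀.smooth_velocity.timeDerivWithin hU).contDiff_slice ht').continuous)
        (hψ.contDiff_slice t).continuous (hψ.hasCompactSupport_slice t)
    have iL' : Integrable (fun x => ν * ⟪u t x, (Δ (ψ t)) x⟫) (volume : Measure E) :=
      (integrable_inner_of_hasCompactSupport_right huc (continuous_laplacian hψ2)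
        ((hψ.hasCompactSupport_slice t).mono' fun x hx => by
          contrapose! hx; simp [laplacian_eq_zero_of_notMem_tsupport hx])).const_mul ν
    calc ∫ x, (⟪u t x, timeDeriv ψ t x⟫ + ν * ⟪u t x, (Δ (ψ t)) x⟫)
        = (∫ x, ⟪u t x, timeDeriv ψ t x⟫) + ∫ x, ⟪timeDerivWithin S₀ u t x, ψ t x⟫ := by
          rw [integral_add i1 iL', integral_const_mul, key]
      _ = ∫ x, D (t, x) := (integral_add i1 i2).symm
  -- integrate the slice identity in time and swap the integrals
  have hstep : ∫ t in Ioo a₁ b₁, ∫ x, (⟪u t x, timeDeriv ψ t x⟫ + ν * ⟪u t x, (Δ (ψ t)) x⟫) =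
      ∫ x, ∫ t in Ioo a₁ b₁, D (t, x) := by
    rw [setIntegral_congr_fun measurableSet_Ioo hslice]
    exact integral_integral_swap (f := fun t x => D (t, x)) hDint
  -- fundamental theorem of calculus on each time line: both boundary terms vanish
  have hline : ∀ x, ∫ t in Ioo a₁ b₁, D (t, x) = 0 := by
    intro x
    have hcont : ContinuousOn (fun t => ⟪u t x, ψ t x⟫) (Icc a₁ b₁) := by
      refine ContinuousOn.inner ?_ ?_
      · exact hu₀.comp (Continuous.prodMk_left x).continuousOn
          fun t ht => mk_mem_prod ht (mem_univ x)
      · exact (hψ.contDiff.continuous.comp (Continuous.prodMk_left x)).continuousOn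
    have hderiv : ∀ t ∈ Ioo a₁ b₁, HasDerivWithinAt (fun t => ⟪u t x, ψ t x⟫) (D (t, x))
        (Ioi t) t := by
      intro t ht
      have hu' : HasDerivAt (fun s => u s x) (timeDerivWithin S₀ u t x) t :=
        (h₀.smooth_velocity.hasDerivWithinAt_timeDerivWithin hU (Ioo_subset_Icc_self ht)
          x).hasDerivAt (Icc_mem_nhds ht.1 ht.2)
      exact (hu'.inner ℝ (hψ.hasDerivAt_time t x)).hasDerivWithinAt
    have hint : IntervalIntegrable (fun t => D (t, x)) volume a₁ b₁ := by
      refine ContinuousOn.intervalIntegrable ?_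
      rw [uIcc_of_le ha₁b₁.le]
      exact hDcont.comp (Continuous.prodMk_left x).continuousOn
        fun t ht => mk_mem_prod ht (mem_univ x)
    have := intervalIntegral.integral_eq_sub_of_hasDeriv_right_of_le ha₁b₁.le hcont hderiv hint
    rw [intervalIntegral.integral_of_le ha₁b₁.le, integral_Ioc_eq_integral_Ioo] at this
    rw [this, hψa₁ x, hψb₁ x, inner_zero_right, inner_zero_right, sub_self]
  rw [hstep, integral_congr_ae (Eventually.of_forall hline), integral_zero]

/-- The weak Stokes identity at `ν = 1` in the combined form consumed by the tree's KNSS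
Lemma 3.1 (`exists_ae_eq_heatExtension_add_const_of_weakStokes`):
`∫ₐᵇ ∫ ⟪u, ∂ₜψ + Δψ⟫ = 0`. [cite: Leray1934, (17) p. 206] -/
theorem weakStokes_of_classical_one {a b : ℝ} {u d : ℝ → E → E} {p : ℝ → E → ℝ}
    (h : IsClassicalNSSolutionOn (Ioo a b) 1 d u p)
    (hd : ∀ t ∈ Ioo a b, ∀ x, d t x = convect (u t) (u t) x)
    (ψ : ℝ → E → E) (hψ : IsSpaceTimeTestOn (slab E (Ioo a b) isOpen_Ioo) ψ)
    (hdiv : ∀ t, VectorCalculus.IsDivFree (ψ t)) :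
    ∫ t in Ioo a b, ∫ x, ⟪u t x, timeDeriv ψ t x + Δ (ψ t) x⟫ = 0 := by
  have h1 := weakStokes_of_classical h hd ψ hψ hdiv
  simp only [one_mul] at h1
  rw [← h1]
  refine setIntegral_congr_fun measurableSet_Ioo fun t _ => ?_
  exact integral_congr_ae (Eventually.of_forall fun x => by
    simp only [inner_add_right])

end Summit.NavierStokesRegularity.AngularGalerkinLadderClassicalWeakStokes

end
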